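import Summits.QuantumFields.YangMills.Theorems.BalabanUVNodesN08LaunderingLocal
import Summits.QuantumFields.YangMills.Theorems.BalabanUVNodesN08AxialLaunderingFirstBond

/-!
# BalabanUVNodes ∕ N08 — THE MARKOV LAUNDERING STEP: one level `j → j+1` from an ARBITRARY finite source law that is invariant under translating the END fine bonds of a near set `A`
# of coarse bonds; the piecewise hybrid step with fired∕ghost set `S` disjoint from `A`, weight and fired values blind to those end bonds ⇒ the `A`-coordinates one level up are
# exactly Haar and independent of all other coordinates — the inductive step (I_j ⇒ I_{j+1}) of the exact-cancellation architecture (memo M6′ §2(c), unit (T1))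

Track A, DAG node N08 ([Balaban1985UV3] Thm 1 p. 257 ∕ Thm 2 p. 272; averaging [Balaban1987RG1] (0.4) p. 253; straight transporter [Balaban1984PropagatorsI] (1.7) p. 18).
Cell `pub-ymgap`, seat `pub-ymgap-dag-n08-d` g47 (R529-ym job; memo `N08-HJ-M6-CANCELLATION-g47.md` (T1)); ledger key `--supports stmt-QuantumFields-27364 --as helper` («cc 19936
(O‴χₛ) supply», director №326).  Over ✓p759076 `…N08LaunderingLocal.map_prod_eq_prod_pi_of_translations` with ONE `axialAvg_mul_last ∕ _first`.

WHY THIS FORM.  In the Markov organisation of the expansion the level-`j` law is no longer `g·Haar` but a term `μ` of the invariant (I_j) (product Haar on the free bonds, anything on the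
live clusters' shadows).  All the Weil core needs from `μ` is INVARIANCE under right multiplication of the last fine bonds `line C (L−1)` of the bonds `C ∈ A ∩ T` and left
multiplication of the first fine bonds `line C 0` of the bonds `C ∈ A ∖ T` (hypotheses `hμR`, `hμL` — true when those bonds are Haar factors of `μ`), and that the weight `f` and the
fired∕ghost values `m c` do not read those end bonds (`hfE`, `hmE`).  No densities, no split of the source.

CONTENTS ([folklore]; 0 `def`, 0 `sorry`): ★★★ `map_pair_eq_prod_of_endInvariant` — `(μ.withDensity f).map (Hyb|Aᶜ, Hyb|A) = ((μ.withDensity f).map Hyb|Aᶜ) ⊗ Haar^A`.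
HONEST: count-neutral helper; one step of an architecture whose assembly (T2)–(T6) is not typed; hTop ∕ hJ NOT proved; N08 NOT discharged; R3 ≠ d = 4 ∕ mass gap ∕ Clay.
-/

noncomputable section

open MeasureTheory
open scoped ENNReal

namespace Summit.QuantumFields.YangMills.Theorems.BalabanUVNodesN08MarkovLaunderingStep

open Literature.MathematicalPhysics.QuantumFieldTheory.Balaban1983to89
open Literature.MathematicalPhysics.QuantumFieldTheory.Balaban1983to89.T4Continuum
open Literature.MathematicalPhysics.QuantumFieldTheory.Balaban1983to89.AveragingRT
open Summit.QuantumFields.YangMills.Theorems.BalabanUVNodesN08AxialLaunderingFirstBond (first_injective axialAvg_mul_first)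
open Summit.QuantumFields.YangMills.Theorems.BalabanUVNodesN08LaunderingLocal (map_prod_eq_prod_pi_of_translations)

variable {P : Params} {j : ℕ} {G : Type*} [GaugeGroup G] [MeasurableSpace G] [HaarData G] [MeasurableMul₂ G] [MeasurableInv G]

/-- ★★★ **THE MARKOV LAUNDERING STEP.**  `μ` a finite measure on level-`j` fields; `A` a near set of level-`(j+1)` bonds, `T ⊆` (those laundered from the right); `μ` invariant under
right multiplication of the bonds `line C (L−1)`, `C ∈ A ∩ T`, and under left multiplication of the bonds `line C 0`, `C ∈ A ∖ T`; `f ≥ 0` measurable, `μ`-integrable, blind to those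
end bonds; fired∕ghost set `S` disjoint from `A` with values `m c` measurable and blind to those end bonds.  Then with `Hyb U c′ := [c′ ∈ S ? m c′ U : axialAvg U c′]`,
`(μ.withDensity f).map (fun U ↦ (Hyb U|Aᶜ, Hyb U|A)) = ((μ.withDensity f).map (Hyb ·|Aᶜ)) ⊗ Haar^A`. [cite: Balaban1987RG1, (0.4) p.253; Balaban1984PropagatorsI, (1.7) p.18] -/
theorem map_pair_eq_prod_of_endInvariant [DecidableEq (PBond P (j + 1))] (hj : j + 1 ≤ P.m + P.K)
    (μ : Measure (GaugeField P j G)) (A T : Set (PBond P (j + 1))) [DecidablePred (· ∈ A)] [DecidablePred (· ∈ T)]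
    (hμR : ∀ h : GaugeField P j G, (∀ b, (¬ ∃ C ∈ A, C ∈ T ∧ b = line C (P.L - 1)) → h b = 1) →
      MeasurePreserving (fun (U : GaugeField P j G) b => U b * h b) μ μ)
    (hμL : ∀ h : GaugeField P j G, (∀ b, (¬ ∃ C ∈ A, C ∉ T ∧ b = line C 0) → h b = 1) →
      MeasurePreserving (fun (U : GaugeField P j G) b => h b * U b) μ μ)
    {f : GaugeField P j G → ℝ≥0∞} (hf : Measurable f) (hfin : ∫⁻ U, f U ∂μ ≠ ∞)
    (hfE : ∀ U U' : GaugeField P j G,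
      (∀ b, (¬ ∃ C ∈ A, (C ∈ T ∧ b = line C (P.L - 1)) ∨ (C ∉ T ∧ b = line C 0)) → U b = U' b) → f U = f U')
    (S : Finset (PBond P (j + 1))) {m : PBond P (j + 1) → GaugeField P j G → G} (hm : ∀ c ∈ S, Measurable (m c))
    (hmE : ∀ c ∈ S, ∀ U U' : GaugeField P j G,
      (∀ b, (¬ ∃ C ∈ A, (C ∈ T ∧ b = line C (P.L - 1)) ∨ (C ∉ T ∧ b = line C 0)) → U b = U' b) → m c U = m c U')
    (hAS : ∀ C ∈ A, C ∉ S) :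
    (μ.withDensity f).map (fun U : GaugeField P j G =>
        ((fun C : ↥Aᶜ => (if (C : PBond P (j + 1)) ∈ S then m C U else axialAvg U C)),
         (fun C : ↥A => (if (C : PBond P (j + 1)) ∈ S then m C U else axialAvg U C)))) =
      ((μ.withDensity f).map (fun U : GaugeField P j G => fun C : ↥Aᶜ => (if (C : PBond P (j + 1)) ∈ S then m C U else axialAvg U C))).prod
        (Measure.pi fun _ : ↥A => (HaarData.haar : Measure G)) := by
  set Hyb : GaugeField P j G → GaugeField P (j + 1) G := fun U c' => if c' ∈ S then m c' U else axialAvg U c' with hHyb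
  have hHybm : Measurable Hyb := by
    refine measurable_pi_iff.mpr fun c' => ?_
    by_cases hc : c' ∈ S
    · simp only [hHyb, hc, if_true]; exact hm c' hc
    · simp only [hHyb, hc, if_false]; exact (measurable_pi_iff.mp measurable_axialAvg) c'
  have hprojA : Measurable (fun (V : GaugeField P (j + 1) G) (C : ↥A) => V C) := measurable_pi_iff.mpr fun C => measurable_pi_apply (C : PBond P (j + 1))
  have hprojB : Measurable (fun (V : GaugeField P (j + 1) G) (C : ↥Aᶜ) => V C) := measurable_pi_iff.mpr fun C => measurable_pi_apply (C : PBond P (j + 1))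
  show (μ.withDensity f).map (fun U => ((fun C : ↥Aᶜ => Hyb U C), (fun C : ↥A => Hyb U C))) =
    ((μ.withDensity f).map (fun U => fun C : ↥Aᶜ => Hyb U C)).prod (Measure.pi fun _ : ↥A => (HaarData.haar : Measure G))
  refine map_prod_eq_prod_pi_of_translations (G := G) μ {a : ↥A | (a : PBond P (j + 1)) ∈ T} hf hfin (hprojA.comp hHybm) (hprojB.comp hHybm) ?_ ?_
  · -- RIGHT: translate the last fine bonds of the bonds of `A ∩ T`
    intro h hh
    set hx : GaugeField P (j + 1) G := fun C' => if hC' : C' ∈ A then h ⟨C', hC'⟩ else 1 with hhx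
    have hxA : ∀ C', C' ∉ A → hx C' = 1 := fun C' hC' => by simp [hhx, hC']
    have hxT : ∀ C', hx C' ≠ 1 → C' ∈ A ∧ C' ∈ T := by
      intro C' hne
      by_cases hC' : C' ∈ A
      · refine ⟨hC', ?_⟩
        by_contra hT
        exact hne (by rw [hhx]; simp only [hC', dif_pos]; exact hh ⟨C', hC'⟩ hT)
      · exact absurd (hxA C' hC') hne
    set kx : GaugeField P j G := Function.extend (fun c₁ : PBond P (j + 1) => line c₁ (P.L - 1)) hx (fun _ => 1) with hkx
    -- support of `kx`
    have hk1 : ∀ b, (¬ ∃ C ∈ A, C ∈ T ∧ b = line C (P.L - 1)) → kx b = 1 := by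
      intro b hb
      by_cases hex : ∃ c₁ : PBond P (j + 1), line c₁ (P.L - 1) = b
      · obtain ⟨c₁, rfl⟩ := hex
        rw [hkx, (last_injective hj).extend_apply]
        by_contra hne
        exact hb ⟨c₁, (hxT c₁ hne).1, (hxT c₁ hne).2, rfl⟩
      · rw [hkx, Function.extend_apply' _ _ _ hex]
    have hk1' : ∀ b, (¬ ∃ C ∈ A, (C ∈ T ∧ b = line C (P.L - 1)) ∨ (C ∉ T ∧ b = line C 0)) → kx b = 1 :=
      fun b hb => hk1 b fun ⟨C, hC, hCT, hb'⟩ => hb ⟨C, hC, Or.inl ⟨hCT, hb'⟩⟩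
    refine ⟨fun U b => U b * kx b, hμR kx hk1, ?_, ?_, ?_⟩
    · intro U
      exact hfE _ _ fun b hb => by show U b * kx b = U b; rw [hk1' b hb, mul_one]
    · intro U
      funext C
      show Hyb (fun b => U b * kx b) C = Hyb U C
      have hC : (C : PBond P (j + 1)) ∉ A := C.2
      by_cases hc : (C : PBond P (j + 1)) ∈ S
      · simp only [hHyb, hc, if_true]
        exact hmE _ hc _ _ fun b hb => by show U b * kx b = U b; rw [hk1' b hb, mul_one]
      · simp only [hHyb, hc, if_false]
        rw [hkx, axialAvg_mul_last hj]
        show axialAvg U C * hx C = axialAvg U C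
        rw [hxA _ hC, mul_one]
    · intro U
      funext a
      show Hyb (fun b => U b * kx b) a = Hyb U a * h a
      have hc : (a : PBond P (j + 1)) ∉ S := hAS _ a.2
      simp only [hHyb, hc, if_false]
      rw [hkx, axialAvg_mul_last hj]
      show axialAvg U a * hx a = axialAvg U a * h a
      rw [hhx]; simp only [a.2, dif_pos]
  · -- LEFT: translate the first fine bonds of the bonds of `A ∖ T`
    intro h hh
    set hx : GaugeField P (j + 1) G := fun C' => if hC' : C' ∈ A then h ⟨C', hC'⟩ else 1 with hhx
    have hxA : ∀ C', C' ∉ A → hx C' = 1 := fun C' hC' => by simp [hhx, hC']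
    have hxT : ∀ C', hx C' ≠ 1 → C' ∈ A ∧ C' ∉ T := by
      intro C' hne
      by_cases hC' : C' ∈ A
      · refine ⟨hC', fun hT => hne ?_⟩
        rw [hhx]; simp only [hC', dif_pos]; exact hh ⟨C', hC'⟩ hT
      · exact absurd (hxA C' hC') hne
    set kx : GaugeField P j G := Function.extend (fun c₁ : PBond P (j + 1) => line c₁ 0) hx (fun _ => 1) with hkx
    have hk1 : ∀ b, (¬ ∃ C ∈ A, C ∉ T ∧ b = line C 0) → kx b = 1 := by
      intro b hb
      by_cases hex : ∃ c₁ : PBond P (j + 1), line c₁ 0 = b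
      · obtain ⟨c₁, rfl⟩ := hex
        rw [hkx, (first_injective hj).extend_apply]
        by_contra hne
        exact hb ⟨c₁, (hxT c₁ hne).1, (hxT c₁ hne).2, rfl⟩
      · rw [hkx, Function.extend_apply' _ _ _ hex]
    have hk1' : ∀ b, (¬ ∃ C ∈ A, (C ∈ T ∧ b = line C (P.L - 1)) ∨ (C ∉ T ∧ b = line C 0)) → kx b = 1 :=
      fun b hb => hk1 b fun ⟨C, hC, hCT, hb'⟩ => hb ⟨C, hC, Or.inr ⟨hCT, hb'⟩⟩
    refine ⟨fun U b => kx b * U b, hμL kx hk1, ?_, ?_, ?_⟩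
    · intro U
      exact hfE _ _ fun b hb => by show kx b * U b = U b; rw [hk1' b hb, one_mul]
    · intro U
      funext C
      show Hyb (fun b => kx b * U b) C = Hyb U C
      have hC : (C : PBond P (j + 1)) ∉ A := C.2
      by_cases hc : (C : PBond P (j + 1)) ∈ S
      · simp only [hHyb, hc, if_true]
        exact hmE _ hc _ _ fun b hb => by show kx b * U b = U b; rw [hk1' b hb, one_mul]
      · simp only [hHyb, hc, if_false]
        rw [hkx, axialAvg_mul_first hj]
        show hx C * axialAvg U C = axialAvg U C
        rw [hxA _ hC, one_mul]
    · intro U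
      funext a
      show Hyb (fun b => kx b * U b) a = h a * Hyb U a
      have hc : (a : PBond P (j + 1)) ∉ S := hAS _ a.2
      simp only [hHyb, hc, if_false]
      rw [hkx, axialAvg_mul_first hj]
      show hx a * axialAvg U a = h a * axialAvg U a
      rw [hhx]; simp only [a.2, dif_pos]

end Summit.QuantumFields.YangMills.Theorems.BalabanUVNodesN08MarkovLaunderingStep

end
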